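import Mathlib
import HarnessLib
import Summits.NavierStokesRegularity.FluidComputer.TriggeredTransferRun
import Summits.NavierStokesRegularity.NavierStokesRegularity.Theorems.AdiabaticEddyClayUniquenessCore

/-!
# A CASCADE of triggered transfers: the alphabet-free input of the gluing argument (door N1-FC,
# analysis half, v2 — `H¹` hand-over states above ignition)

Cell `ns-blowup`, seat `ns-blowup-fc-prover-1` (g5; D-0074 GROUP C «bridge support», door N1-FC).
Companion of `TriggeredTransfer.lean` (the door TYPE `TriggerScheme`, `Step`, `Transfers`; seat
`ns-blowup-fc-route`) and of `TriggeredTransferRun.lean` (this seat, g2: `Link`, `seedAt`, `Run`).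
LABEL: E–C bookkeeping. WHAT THIS IS NOT: not Navier–Stokes evidence and not a construction — two
TYPES and their bookkeeping; a `Cascade` is inhabited here only from a `Run`, i.e. under the OPEN
predicate `TriggerScheme.Transfers ν`, asserted nowhere in the tree; no scheme instance is claimed.

## Why (the diagnosis behind door v2)

The g2 gluing chain `TriggeredTransferRun/Clock/Pieces/Gluing/Witness` assembles, from a linked
`Run` of a transferring scheme, an exact forced blow-up `BreakdownWitness ν`. Along that chain the
scheme's Clay axiom `TriggerScheme.clay` (every member of every `F U` is smooth, divergence free AND
RAPIDLY DECAYING) is consumed in exactly two places: (i) at each JUNCTION, to know that the zoomed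
hand-over state is an `H¹` datum for Tao's unconditional uniqueness (Anal. PDE 2013, Cor. 11.4 — the
tree theorem `tao_unconditional_uniqueness_velocity_holds` asks only `u₀ ∈ L²`, `∇u₀ ∈ L²`); (ii) at
LEVEL `0`, for Fefferman's datum clause (4) of the witness. But `TriggerScheme.Step` hands over, at a
POSITIVE time `T` of a viscous flow, EXACTLY into a member — hence into a rapidly decaying state: a
codimension-`∞` demand (instantaneous spatial spreading of viscous flows) that has nothing to do
with the transfer physics the door is meant to isolate (fc-prover-2 g2 note (b) / g4 «Reading» (4)).

## What (this file)

The alphabet-free input the gluing actually needs: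

* `TriggerScheme.Piece ν U ε w` — the data of one triggered transfer EXACTLY as `Link ν U ε w`
  (hand-over time, margin, trigger, classical solution, energy, hand-over identity to a `λ`-zoomed
  state `w'` at amplitude `U' ≥ growth · U`, child centre) MINUS the clause `w' ∈ F U'`;
  `Link.toPiece`.
* `TriggerScheme.Cascade ν` — a linked sequence of pieces fired with the level seeds
  `seedAt ν n (U n)`: `U (n+1) = (link n).U'`, `w (n+1) = (link n).w'`, starting at or above
  threshold; the level-`0` state is a Clay datum (`decay_zero`); EVERY state is smooth, divergence
  free and in `H¹` (`h1`) and carries the speed floor `c · U n` in the nest ball. Nothing else.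
  `Run.toCascade` (a v1 run is a cascade: Clay ⇒ `H¹` by `ClayUniqueness.memLp_two_of_rapidDecay`),
  `nonempty_cascade_of_transfers`.
* the bookkeeping of `TriggeredTransferRun` along a cascade, verbatim: geometric climb
  `U 0 · growthⁿ ≤ U n → ∞`, thresholds, hand-over identity, the polynomial level clock
  `T_n ≤ C_τ (1 + n² log λ)^q / U n`, seed sizes.

The companion files `TriggeredTransferCascadeClock/…Pieces/…Solution/…Witness` re-run the g2 chain
over `Cascade` (junction by `H¹`) and conclude `Nonempty (𝒮.Cascade ν) → NavierStokesBreakdownR3`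
with NO named fact; `TriggeredTransferH1.lean` is the door v2 whose `Transfers` produces a cascade
from an `H¹` working alphabet. The field of a cascade is called `link` (not `piece`) so that the
g2 proofs port verbatim.

References: T. Tao, J. Amer. Math. Soc. 29 (2016) §1.3 (machine paradigm) [cite: Tao2016AveragedNS, §1.3];
T. Tao, Anal. PDE 6 (2013), Cor. 11.4 [cite: Tao2011, Cor. 11.4]; C. L. Fefferman, Clay problem
description (A)(4), (C) [cite: FeffermanClay2006, (C)]. 0 sorry; axioms ⊆ {propext, Classical.choice, Quot.sound}.
-/

noncomputable section

namespace Summit.NavierStokesRegularity.FluidComputer.TriggeredTransfer.TriggerScheme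

open Set Filter Function MeasureTheory
open scoped Topology ENNReal ContDiff
open Literature.Analysis.FluidPDE
open Literature.Analysis.FluidPDE.FluidComputer (E3 Vel)

variable (𝒮 : TriggerScheme)

/-! ## One triggered transfer, alphabet-free -/

/-- **The data of one triggered transfer, without alphabet membership** at viscosity `ν`, from the
unit-scale state `w` of amplitude `U`, with trigger amplitude `ε`: hand-over time `T`, margin `δ`
(`0 < δ`, `2δ < T`, `T ≤ C_τ (1 + |log ε|)^q / U`), an admissible trigger `g`, an exact classical
solution `(u, p)` of the system forced by `g` on `[0, T + δ]` with `u 0 = w` and finite energy, and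
the hand-over `u T = (x ↦ λ • w' (λ • (x - x₀)))` to SOME state `w'` at amplitude
`U' ≥ growth · U`, `‖x₀‖ ≤ D`. Exactly `TriggerScheme.Link ν U ε w` minus the clause `w' ∈ F U'`
(the regularity of `w'` is recorded by the `Cascade` carrying the piece). A TYPE of witnesses.
[cite: Tao2016AveragedNS, §1.3] -/
structure Piece (ν U ε : ℝ) (w : Vel) where
  /-- hand-over time -/
  T : ℝ
  /-- margin: the piece starts and ends with an unforced layer of length `δ` -/
  δ : ℝ
  /-- the trigger -/
  g : ℝ → Vel
  /-- velocity of the piece -/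
  u : ℝ → Vel
  /-- pressure of the piece -/
  p : ℝ → E3 → ℝ
  /-- amplitude of the hand-over state -/
  U' : ℝ
  /-- the state handed over to (unit scale) -/
  w' : Vel
  /-- centre of the child (unit scale of the parent) -/
  x₀ : E3
  δ_pos : 0 < δ
  two_δ_lt : 2 * δ < T
  T_le : T ≤ 𝒮.Cτ * (1 + |Real.log ε|) ^ 𝒮.q / U
  trigger : 𝒮.IsTrigger ε δ T g
  classical : IsClassicalNSSolutionOn (Icc 0 (T + δ)) ν g u p
  initial : u 0 = w
  energy : ∃ C : ℝ≥0∞, C < ⊤ ∧ ∀ t ∈ Icc 0 (T + δ), ∫⁻ x, ‖u t x‖ₑ ^ 2 ≤ C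
  growth_le : 𝒮.growth * U ≤ U'
  norm_x₀_le : ‖x₀‖ ≤ 𝒮.D
  handover : u T = fun x => 𝒮.lam • w' (𝒮.lam • (x - x₀))

variable {𝒮} in
/-- A `Link` (hand-over INTO the alphabet) is in particular a `Piece` (forget the membership). [folklore] -/
def Link.toPiece {ν U ε : ℝ} {w : Vel} (L : 𝒮.Link ν U ε w) : 𝒮.Piece ν U ε w where
  T := L.T
  δ := L.δ
  g := L.g
  u := L.u
  p := L.p
  U' := L.U'
  w' := L.w'
  x₀ := L.x₀
  δ_pos := L.δ_pos
  two_δ_lt := L.two_δ_lt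
  T_le := L.T_le
  trigger := L.trigger
  classical := L.classical
  initial := L.initial
  energy := L.energy
  growth_le := L.growth_le
  norm_x₀_le := L.norm_x₀_le
  handover := L.handover

namespace Piece

variable {𝒮} {ν U ε : ℝ} {w : Vel}

/-- The margin is shorter than the hand-over time: `δ < T`. [folklore] -/
theorem δ_lt_T (L : 𝒮.Piece ν U ε w) : L.δ < L.T := by linarith [L.δ_pos, L.two_δ_lt]

/-- The hand-over time is positive. [folklore] -/
theorem T_pos (L : 𝒮.Piece ν U ε w) : 0 < L.T := L.δ_pos.trans L.δ_lt_T

/-- The piece lives on a non-degenerate slab: `0 < T + δ`. [folklore] -/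
theorem T_add_δ_pos (L : 𝒮.Piece ν U ε w) : 0 < L.T + L.δ := add_pos L.T_pos L.δ_pos

/-- The hand-over time lies in the slab `[0, T + δ]`. [folklore] -/
theorem T_mem_Icc (L : 𝒮.Piece ν U ε w) : L.T ∈ Icc 0 (L.T + L.δ) := ⟨L.T_pos.le, by linarith [L.δ_pos]⟩

/-- Time `0` lies in the slab `[0, T + δ]`. [folklore] -/
theorem zero_mem_Icc (L : 𝒮.Piece ν U ε w) : (0 : ℝ) ∈ Icc 0 (L.T + L.δ) := ⟨le_rfl, L.T_add_δ_pos.le⟩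

/-- If the source amplitude is at least the threshold then so is the target amplitude
(`U' ≥ growth · U ≥ U ≥ U⋆`). [folklore] -/
theorem UStar_le_U' (L : 𝒮.Piece ν U ε w) (hU : 𝒮.UStar ≤ U) : 𝒮.UStar ≤ L.U' :=
  hU.trans ((le_mul_of_one_le_left (𝒮.UStar_pos.le.trans hU) 𝒮.one_le_growth).trans L.growth_le)

/-- The trigger is switched off at and after the hand-over time. [folklore] -/
theorem g_eq_zero_of_T_le (L : 𝒮.Piece ν U ε w) {t : ℝ} (ht : L.T ≤ t) : L.g t = 0 := L.trigger.off_late t ht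

/-- The trigger is switched off during the initial layer `t ≤ δ`. [folklore] -/
theorem g_eq_zero_of_le_δ (L : 𝒮.Piece ν U ε w) {t : ℝ} (ht : t ≤ L.δ) : L.g t = 0 := L.trigger.off_early t ht

end Piece

/-- The data of a `Link` and of its `Piece` agree (all fields are copied). [folklore] -/
@[simp] theorem Link.toPiece_T {ν U ε : ℝ} {w : Vel} (L : 𝒮.Link ν U ε w) : L.toPiece.T = L.T := rfl

/-! ## Cascades -/

/-- **A cascade of triggered transfers at viscosity `ν`** — the alphabet-free input of the gluing
argument: level amplitudes `U n`, level states `w n`, and for every level the data `link n` of one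
triggered transfer fired from `w n` with the level seed `seedAt ν n (U n)`, LINKED (`U_succ`, `w_succ`:
the hand-over amplitude and state of level `n` are the source amplitude and state of level `n + 1`),
starting at or above threshold; the ignition state `w 0` is a Clay datum (rapid decay, Fefferman
(4)); every state is smooth, divergence free and in `H¹` (`u₀, ∇u₀ ∈ L²` — all the junctions need);
every state has speed at least `c · U n` somewhere in the closed nest ball. NO alphabet: how the
states are produced (a designed family closed under the dynamics, `TriggerScheme.Transfers`; an
enlarged `H¹` working alphabet, `TriggerSchemeH1.Transfers`; …) is the business of the door, not of
the gluing. A TYPE; inhabited from a `Run` (`Run.toCascade`), never otherwise claimed.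
[cite: Tao2016AveragedNS, §1.3] -/
structure Cascade (ν : ℝ) where
  /-- level amplitudes (level Reynolds numbers at unit viscosity) -/
  U : ℕ → ℝ
  /-- level states (unit scale) -/
  w : ℕ → Vel
  /-- the triggered transfer of level `n`, with its data (no alphabet membership) -/
  link : ∀ n, 𝒮.Piece ν (U n) (𝒮.seedAt ν n (U n)) (w n)
  UStar_le_zero : 𝒮.UStar ≤ U 0
  U_succ : ∀ n, U (n + 1) = (link n).U'
  w_succ : ∀ n, w (n + 1) = (link n).w'
  /-- the ignition state is a Clay datum: Fefferman's (4) -/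
  decay_zero : HasRapidSpatialDecay (w 0)
  /-- every level state is smooth -/
  smooth : ∀ n, ContDiff ℝ ∞ (w n)
  /-- every level state is divergence free -/
  divFree : ∀ n, NSWave0.IsDivFree (w n)
  /-- every level state is an `H¹` datum: `w n ∈ L²`, `∇(w n) ∈ L²` -/
  h1 : ∀ n, MemLp (w n) 2 volume ∧ MemLp (fderiv ℝ (w n)) 2 volume
  /-- speed floor: the level state of amplitude `U n` has speed `≥ c · U n` somewhere in the nest ball -/
  floor : ∀ n, ∃ x : E3, ‖x‖ ≤ 𝒮.R ∧ 𝒮.c * U n ≤ ‖w n x‖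

variable {𝒮} in
/-- **A linked run of a (v1) scheme is a cascade**: forget the alphabet; the Clay clause of the
members gives smoothness, incompressibility, rapid decay at level `0` and `H¹` at every level
(`ClayUniqueness.memLp_two_of_rapidDecay`: Schwartz ⇒ `H¹`); the floors are the scheme's. [folklore] -/
def Run.toCascade {ν : ℝ} (ρ : 𝒮.Run ν) : 𝒮.Cascade ν where
  U := ρ.U
  w := ρ.w
  link n := (ρ.link n).toPiece
  UStar_le_zero := ρ.UStar_le_zero
  U_succ := ρ.U_succ
  w_succ := ρ.w_succ
  decay_zero := ρ.hasRapidSpatialDecay_w 0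
  smooth := ρ.contDiff_w
  divFree := ρ.isDivFree_w
  h1 n :=
    Summit.NavierStokesRegularity.NavierStokesRegularity.Theorems.ClayUniqueness.memLp_two_of_rapidDecay
      (ρ.hasRapidSpatialDecay_w n) ((ρ.contDiff_w n).of_le (by norm_cast))
  floor := ρ.exists_floor

/-- **A transferring scheme has a cascade** (`ν > 0`): its linked run (`nonempty_run`, dependent
choice from the ignition member) read as a cascade. [cite: Tao2016AveragedNS, §1.3] -/
theorem nonempty_cascade_of_transfers {ν : ℝ} (hν : 0 < ν) (hT : 𝒮.Transfers ν) :
    Nonempty (𝒮.Cascade ν) := by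
  obtain ⟨ρ⟩ := 𝒮.nonempty_run hν hT
  exact ⟨ρ.toCascade⟩

namespace Cascade

variable {𝒮} {ν : ℝ}

/-- The amplitudes climb by the growth factor: `growth · U n ≤ U (n+1)` (`Re_{k+1} ≥ (ηλ)^{1/2} Re_k`). [folklore] -/
theorem growth_mul_le (ρ : 𝒮.Cascade ν) (n : ℕ) : 𝒮.growth * ρ.U n ≤ ρ.U (n + 1) := by
  rw [ρ.U_succ n]
  exact (ρ.link n).growth_le

/-- Every amplitude of a cascade is at or above the threshold. [folklore] -/
theorem UStar_le (ρ : 𝒮.Cascade ν) (n : ℕ) : 𝒮.UStar ≤ ρ.U n :=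
  𝒮.UStar_le_of_chain ρ.growth_mul_le ρ.UStar_le_zero n

/-- Every amplitude of a cascade is positive. [folklore] -/
theorem U_pos (ρ : 𝒮.Cascade ν) (n : ℕ) : 0 < ρ.U n := 𝒮.UStar_pos.trans_le (ρ.UStar_le n)

/-- **Geometric climb**: `U 0 · growthⁿ ≤ U n`. [folklore] -/
theorem mul_pow_le (ρ : 𝒮.Cascade ν) (n : ℕ) : ρ.U 0 * 𝒮.growth ^ n ≤ ρ.U n :=
  𝒮.mul_pow_le_of_chain ρ.growth_mul_le n

/-- The amplitudes are non-decreasing along a cascade. [folklore] -/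
theorem U_le_succ (ρ : 𝒮.Cascade ν) (n : ℕ) : ρ.U n ≤ ρ.U (n + 1) :=
  𝒮.le_succ_of_chain ρ.growth_mul_le (ρ.U_pos n).le

/-- The amplitudes are monotone along a cascade. [folklore] -/
theorem monotone_U (ρ : 𝒮.Cascade ν) : Monotone ρ.U := monotone_nat_of_le_succ ρ.U_le_succ

/-- **The level Reynolds numbers of a cascade tend to infinity.** [folklore] -/
theorem tendsto_U (ρ : 𝒮.Cascade ν) : Tendsto ρ.U atTop atTop :=
  𝒮.tendsto_atTop_of_chain ρ.growth_mul_le (ρ.U_pos 0)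

/-- The states of a cascade are smooth. [folklore] -/
theorem contDiff_w (ρ : 𝒮.Cascade ν) (n : ℕ) : ContDiff ℝ ∞ (ρ.w n) := ρ.smooth n

/-- The states of a cascade are divergence free. [folklore] -/
theorem isDivFree_w (ρ : 𝒮.Cascade ν) (n : ℕ) : NSWave0.IsDivFree (ρ.w n) := ρ.divFree n

/-- The ignition state of a cascade decays rapidly with all derivatives (Clay (4)). [folklore] -/
theorem hasRapidSpatialDecay_w_zero (ρ : 𝒮.Cascade ν) : HasRapidSpatialDecay (ρ.w 0) := ρ.decay_zero

/-- The states of a cascade are in `L²`. [folklore] -/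
theorem memLp_w (ρ : 𝒮.Cascade ν) (n : ℕ) : MemLp (ρ.w n) 2 volume := (ρ.h1 n).1

/-- The gradients of the states of a cascade are in `L²`. [folklore] -/
theorem memLp_fderiv_w (ρ : 𝒮.Cascade ν) (n : ℕ) : MemLp (fderiv ℝ (ρ.w n)) 2 volume := (ρ.h1 n).2

/-- **Speed floor of the level states**: `‖w n x‖ ≥ c · U n` somewhere in the closed nest ball. [folklore] -/
theorem exists_floor (ρ : 𝒮.Cascade ν) (n : ℕ) : ∃ x : E3, ‖x‖ ≤ 𝒮.R ∧ 𝒮.c * ρ.U n ≤ ‖ρ.w n x‖ := ρ.floor n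

/-- The piece of level `n` starts at the level state: `(link n).u 0 = w n`. [folklore] -/
theorem u_zero (ρ : 𝒮.Cascade ν) (n : ℕ) : (ρ.link n).u 0 = ρ.w n := (ρ.link n).initial

/-- **The hand-over identity along a cascade**: the piece of level `n` at its hand-over time is the
`λ`-zoom of the NEXT state about the child centre,
`(link n).u T_n = (x ↦ λ • w (n+1) (λ • (x - x₀)))`. [folklore] -/
theorem handover (ρ : 𝒮.Cascade ν) (n : ℕ) :
    (ρ.link n).u (ρ.link n).T = fun x => 𝒮.lam • ρ.w (n + 1) (𝒮.lam • (x - (ρ.link n).x₀)) := by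
  rw [ρ.w_succ n]
  exact (ρ.link n).handover

/-- **The level clock is polynomial in the level**: `T_n ≤ C_τ (1 + n² log λ)^q / U n` (`ν > 0`). [folklore] -/
theorem T_le (ρ : 𝒮.Cascade ν) (hν : 0 < ν) (n : ℕ) :
    (ρ.link n).T ≤ 𝒮.Cτ * (1 + (n : ℝ) ^ 2 * Real.log 𝒮.lam) ^ 𝒮.q / ρ.U n :=
  (ρ.link n).T_le.trans (𝒮.clock_le_of_seedAt hν n (ρ.U_pos n))

/-- The level clock against the geometric climb: `T_n ≤ C_τ (1 + n² log λ)^q / (U 0 · growthⁿ)`. [folklore] -/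
theorem T_le_geometric (ρ : 𝒮.Cascade ν) (hν : 0 < ν) (n : ℕ) :
    (ρ.link n).T ≤ 𝒮.Cτ * (1 + (n : ℝ) ^ 2 * Real.log 𝒮.lam) ^ 𝒮.q / (ρ.U 0 * 𝒮.growth ^ n) := by
  refine (ρ.T_le hν n).trans ?_
  have hnum : 0 ≤ 𝒮.Cτ * (1 + (n : ℝ) ^ 2 * Real.log 𝒮.lam) ^ 𝒮.q :=
    mul_nonneg 𝒮.Cτ_pos.le (pow_nonneg (by
      have := Real.log_nonneg 𝒮.one_lt_lam.le
      positivity) _)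
  exact div_le_div_of_nonneg_left hnum (mul_pos (ρ.U_pos 0) (pow_pos 𝒮.growth_pos n))
    (ρ.mul_pow_le n)

/-- The level seed of a cascade lies in `(0, 1]`. [folklore] -/
theorem seedAt_le_one (ρ : 𝒮.Cascade ν) (hν : 0 < ν) (n : ℕ) : 𝒮.seedAt ν n (ρ.U n) ≤ 1 :=
  𝒮.seedAt_le_one hν n (ρ.U_pos n).le

/-- The canonical part of the level seed against the geometric climb:
`exp (-(a U_n / ν)) ≤ exp (-(a U_0 growthⁿ / ν))` (`ν > 0`). [folklore] -/
theorem exp_seed_le_geometric (ρ : 𝒮.Cascade ν) (hν : 0 < ν) (n : ℕ) :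
    Real.exp (-(𝒮.a * ρ.U n / ν)) ≤ Real.exp (-(𝒮.a * (ρ.U 0 * 𝒮.growth ^ n) / ν)) := by
  rw [Real.exp_le_exp, neg_le_neg_iff]
  exact div_le_div_of_nonneg_right (mul_le_mul_of_nonneg_left (ρ.mul_pow_le n) 𝒮.a_pos.le) hν.le

end Cascade

/-! ## A run and its cascade carry the same data -/

namespace Run

variable {𝒮} {ν : ℝ}

/-- The cascade of a run has the run's amplitudes. [folklore] -/
@[simp] theorem toCascade_U (ρ : 𝒮.Run ν) : ρ.toCascade.U = ρ.U := rfl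

/-- The cascade of a run has the run's states. [folklore] -/
@[simp] theorem toCascade_w (ρ : 𝒮.Run ν) : ρ.toCascade.w = ρ.w := rfl

/-- The cascade of a run has the run's hand-over times. [folklore] -/
@[simp] theorem toCascade_T (ρ : 𝒮.Run ν) (n : ℕ) : (ρ.toCascade.link n).T = (ρ.link n).T := rfl

/-- The cascade of a run has the run's pieces (velocity). [folklore] -/
@[simp] theorem toCascade_u (ρ : 𝒮.Run ν) (n : ℕ) : (ρ.toCascade.link n).u = (ρ.link n).u := rfl

/-- The cascade of a run has the run's triggers. [folklore] -/
@[simp] theorem toCascade_g (ρ : 𝒮.Run ν) (n : ℕ) : (ρ.toCascade.link n).g = (ρ.link n).g := rfl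

end Run

end Summit.NavierStokesRegularity.FluidComputer.TriggeredTransfer.TriggerScheme

end
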